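import Summits.NavierStokesRegularity.NavierStokesRegularity.Theorems.ExtremiserTransienceDissipationLedgerFarField
import Summits.NavierStokesRegularity.NavierStokesRegularity.Theorems.ExtremiserTransienceDissipationLedgerDefs
import Literature.Analysis.FluidPDE.TypeIAncientMildClassical
import Literature.Analysis.FluidPDE.ClassicalLocalEnergyNoJump
import Literature.Analysis.FluidPDE.MildSolutionProofs
import Literature.Analysis.FluidPDE.LeraySeparationOfEnergyTools
import HarnessLib

/-!
# Dissipation ledger (LINE g10-α, crux 26567), stub L1 — measure-theoretic glue for the dissipation budget

Helper file for the registered stub `stub_dissipationBudget` (L1 `DissipationBudget`) of LINE g10-α `dissipation_ledger`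
(crux `NearExtremalTransiencePerFlow`, stmt-NavierStokesRegularity-26567).  Three pieces of glue between the Bochner integrals of the
classical local energy identity (tree `IsClassicalNSSolutionOn.local_energy_identity_cutoff`) and the line's `withDensity` dissipation
measure `dissMeasure`:

* `tsupport_cutoff_one_subset_closedBall_two`, `integral_mul_norm_sq_le_of_tsupport` — a weight supported in `B̄(0,2)` and bounded by `M`
  integrates against `‖v‖²` by at most `M ∫_{B(0,3)} ‖v‖²`;
* `integral_inv_sqrt_neg` — `∫_{τ₁}^{τ₂} ds/√(−s) = 2(√(−τ₁) − √(−τ₂))`, the only time-singular factor of the flux (no logarithm);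
* `dissMeasure_le_ofReal_integral` — `dissMeasure W ([τ₁,τ₂] × B(x,R)) ≤ ∫_{τ₁}^{τ₂}∫ |∇W|²_F φ` for a Type-I ancient mild `W`, `τ₁ < τ₂ < 0`,
  and any continuous compactly supported `φ ≥ 0` with `φ = 1` on `B(x,R)` (operator norm `≤` Frobenius norm, Tonelli on the closed slab
  where the slice derivative is jointly continuous).

HONEST FRAMING: bookkeeping; nothing about Navier–Stokes regularity or blow-up is proved; no summit is proved by a line.
[cite: CaffarelliKohnNirenberg1982, §2 (2.5)]
-/

noncomputable section

open MeasureTheory Set Filter Metric Topology Function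
open scoped ENNReal NNReal Laplacian InnerProductSpace

namespace Summit.NavierStokesRegularity.NavierStokesRegularity.Theorems

set_option linter.dupNamespace false

namespace NearExtremalTransiencePerFlow.DissipationLedger

open Literature.Analysis Literature.Analysis.FluidPDE

-- nested operator types
set_option maxSynthPendingDepth 3

/-! ### The unit cut-off `χ₁` -/

/-- The support of `χ₁ = cutoff 1` lies in `B̄(0,2)` (the tree's `tsupport_cutoff_subset` at `R = 1`). [folklore] -/
theorem tsupport_cutoff_one_subset_closedBall_two :
    tsupport (cutoff (1 : ℝ) : EuclideanSpace ℝ (Fin 3) → ℝ) ⊆ closedBall (0 : EuclideanSpace ℝ (Fin 3)) 2 := by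
  have h := tsupport_cutoff_subset (E := EuclideanSpace ℝ (Fin 3)) (R := 1) one_pos
  rwa [mul_one] at h

/-- A function supported in `B̄(0,2)` and bounded by `M` in absolute value integrates against `‖v‖²` by at most `M ∫_{B(0,3)}‖v‖²`.
[folklore] -/
theorem integral_mul_norm_sq_le_of_tsupport {g : EuclideanSpace ℝ (Fin 3) → ℝ} {M : ℝ}
    (hg : tsupport g ⊆ closedBall (0 : EuclideanSpace ℝ (Fin 3)) 2) (hM : ∀ x, |g x| ≤ M)
    {v : EuclideanSpace ℝ (Fin 3) → EuclideanSpace ℝ (Fin 3)} (hv : Continuous v) :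
    ∫ x, |g x| * ‖v x‖ ^ 2 ≤ M * ∫ x in ball (0 : EuclideanSpace ℝ (Fin 3)) 3, ‖v x‖ ^ 2 := by
  have hM0 : 0 ≤ M := (abs_nonneg _).trans (hM 0)
  have hdom : ∀ x, |g x| * ‖v x‖ ^ 2 ≤ (ball (0 : EuclideanSpace ℝ (Fin 3)) 3).indicator (fun x => M * ‖v x‖ ^ 2) x := by
    intro x
    by_cases hx : x ∈ tsupport g
    · have hx3 : x ∈ ball (0 : EuclideanSpace ℝ (Fin 3)) 3 := by
        have := hg hx
        rw [mem_closedBall, dist_zero_right] at this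
        rw [mem_ball_zero_iff]; linarith
      rw [indicator_of_mem hx3]
      exact mul_le_mul_of_nonneg_right (hM x) (sq_nonneg _)
    · rw [image_eq_zero_of_notMem_tsupport hx, abs_zero, zero_mul]
      exact indicator_nonneg (fun y _ => by positivity) x
  calc ∫ x, |g x| * ‖v x‖ ^ 2 ≤ ∫ x, (ball (0 : EuclideanSpace ℝ (Fin 3)) 3).indicator (fun x => M * ‖v x‖ ^ 2) x := by
        refine integral_mono_of_nonneg (ae_of_all _ fun x => by positivity) ?_ (ae_of_all _ hdom)
        exact IntegrableOn.integrable_indicator (by exact (integrableOn_norm_sq_ball hv 0 3).const_mul M) measurableSet_ball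
    _ = M * ∫ x in ball (0 : EuclideanSpace ℝ (Fin 3)) 3, ‖v x‖ ^ 2 := by
        rw [integral_indicator measurableSet_ball, integral_const_mul]

/-! ### The time integral of the singular factor -/

/-- `∫_{τ₁}^{τ₂} ds/√(−s) = 2(√(−τ₁) − √(−τ₂))` for `τ₁ ≤ τ₂ < 0`. [folklore] -/
theorem integral_inv_sqrt_neg {τ₁ τ₂ : ℝ} (h12 : τ₁ ≤ τ₂) (h2 : τ₂ < 0) :
    ∫ s in τ₁..τ₂, (Real.sqrt (-s))⁻¹ = 2 * (Real.sqrt (-τ₁) - Real.sqrt (-τ₂)) := by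
  have hderiv : ∀ s ∈ uIcc τ₁ τ₂, HasDerivAt (fun s => -2 * Real.sqrt (-s)) ((Real.sqrt (-s))⁻¹) s := by
    intro s hs
    rw [uIcc_of_le h12] at hs
    have hs0 : 0 < -s := by linarith [hs.2]
    have h1 : HasDerivAt (fun s : ℝ => -s) (-1) s := hasDerivAt_neg s
    have h2 : HasDerivAt (fun s : ℝ => Real.sqrt (-s)) (1 / (2 * Real.sqrt (-s)) * (-1)) s :=
      (Real.hasDerivAt_sqrt hs0.ne').comp s h1
    have h3 : HasDerivAt (fun s : ℝ => -2 * Real.sqrt (-s)) (-2 * (1 / (2 * Real.sqrt (-s)) * (-1))) s :=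
      h2.const_mul (-2)
    have hsq : Real.sqrt (-s) ≠ 0 := (Real.sqrt_pos.2 hs0).ne'
    have e : -2 * (1 / (2 * Real.sqrt (-s)) * (-1)) = (Real.sqrt (-s))⁻¹ := by
      field_simp
    rw [← e]
    exact h3
  have hcont : ContinuousOn (fun s => (Real.sqrt (-s))⁻¹) (uIcc τ₁ τ₂) := by
    refine ContinuousOn.inv₀ (by fun_prop) fun s hs => ?_
    rw [uIcc_of_le h12] at hs
    exact (Real.sqrt_pos.2 (by linarith [hs.2])).ne'
  rw [intervalIntegral.integral_eq_sub_of_hasDerivAt hderiv (hcont.intervalIntegrable)]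
  ring

/-! ### From the Bochner double integral of the identity to the dissipation measure -/

/-- **The dissipation measure of a parabolic cylinder is at most the localised dissipation of the local energy identity**:
`dissMeasure W ([τ₁,τ₂] × B(x,R)) ≤ ∫_{τ₁}^{τ₂} ∫ |∇W|²_F φ` for `τ₁ < τ₂ < 0` and every continuous compactly supported `φ ≥ 0` with `φ = 1` on
`B(x,R)` (operator norm `≤` Frobenius norm; Tonelli for the jointly continuous integrand). [folklore] -/
theorem dissMeasure_le_ofReal_integral {K : ℝ} {W : ℝ → EuclideanSpace ℝ (Fin 3) → EuclideanSpace ℝ (Fin 3)}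
    (hW : IsTypeIAncientMild K W) {τ₁ τ₂ : ℝ} (h12 : τ₁ < τ₂) (h2 : τ₂ < 0) (x : EuclideanSpace ℝ (Fin 3)) (R : ℝ)
    {φ : EuclideanSpace ℝ (Fin 3) → ℝ} (hφc : Continuous φ) (hφcs : HasCompactSupport φ) (hφ0 : ∀ w, 0 ≤ φ w)
    (hφ1 : ∀ w ∈ ball x R, φ w = 1) :
    dissMeasure W (Icc τ₁ τ₂ ×ˢ ball x R) ≤
      ENNReal.ofReal (∫ s in τ₁..τ₂, ∫ w, frobeniusNormSq (fderiv ℝ (W s) w) * φ w) := by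
  -- the integrand `G` and the slice functional `g`
  set G : ℝ × EuclideanSpace ℝ (Fin 3) → ℝ≥0∞ := fun p =>
    ENNReal.ofReal (frobeniusNormSq (fderiv ℝ (W p.1) p.2) * φ p.2) with hG
  set g : ℝ → ℝ := fun s => ∫ w, frobeniusNormSq (fderiv ℝ (W s) w) * φ w with hg
  have hIcc0 : ∀ s ∈ Icc τ₁ τ₂, s < 0 := fun s hs => hs.2.trans_lt h2
  -- joint continuity of the slice derivative on the closed window
  have hsub : Icc τ₁ τ₂ ×ˢ (univ : Set (EuclideanSpace ℝ (Fin 3))) ⊆ Iio 0 ×ˢ univ :=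
    prod_mono (fun s hs => hIcc0 s hs) le_rfl
  have hW1 : ContDiffOn ℝ 1 (uncurry W) (Icc τ₁ τ₂ ×ˢ univ) := (hW.contDiffOn.of_le (by norm_cast)).mono hsub
  have hDc : ContinuousOn (fun p : ℝ × EuclideanSpace ℝ (Fin 3) => fderiv ℝ (W p.1) p.2) (Icc τ₁ τ₂ ×ˢ univ) :=
    continuousOn_fderiv_slice_of_contDiffOn hW1 (uniqueDiffOn_Icc h12)
  have hGc : ContinuousOn G (Icc τ₁ τ₂ ×ˢ univ) := by
    refine ENNReal.continuous_ofReal.comp_continuousOn ?_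
    exact (LerayHopfProofs.continuous_frobeniusNormSq.comp_continuousOn hDc).mul (hφc.comp continuous_snd).continuousOn
  -- step 1: pointwise on the cylinder
  have hmeasS : MeasurableSet (Icc τ₁ τ₂ ×ˢ ball x R) := measurableSet_Icc.prod measurableSet_ball
  have hstep1 : dissMeasure W (Icc τ₁ τ₂ ×ˢ ball x R) ≤ ∫⁻ p in Icc τ₁ τ₂ ×ˢ ball x R, G p := by
    unfold dissMeasure
    rw [withDensity_apply _ hmeasS]
    refine lintegral_mono_ae ((ae_restrict_iff' hmeasS).2 (ae_of_all _ fun p hp => ?_))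
    have hx1 : φ p.2 = 1 := hφ1 p.2 hp.2
    rw [hG]; dsimp only; rw [hx1, mul_one]
    exact enorm_opNorm_sq_le_ofReal_frobeniusNormSq _
  -- step 2: enlarge to the closed slab and apply Tonelli
  have hstep2 : ∫⁻ p in Icc τ₁ τ₂ ×ˢ ball x R, G p ≤ ∫⁻ p in Icc τ₁ τ₂ ×ˢ (univ : Set (EuclideanSpace ℝ (Fin 3))), G p :=
    lintegral_mono_set (prod_mono le_rfl (subset_univ _))
  have hprod : (volume : Measure (ℝ × EuclideanSpace ℝ (Fin 3))).restrict (Icc τ₁ τ₂ ×ˢ univ) =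
      ((volume : Measure ℝ).restrict (Icc τ₁ τ₂)).prod (volume : Measure (EuclideanSpace ℝ (Fin 3))) := by
    rw [Measure.volume_eq_prod, ← Measure.restrict_univ (μ := (volume : Measure (EuclideanSpace ℝ (Fin 3)))),
      Measure.prod_restrict, Measure.restrict_univ]
  have hGm : AEMeasurable G (((volume : Measure ℝ).restrict (Icc τ₁ τ₂)).prod (volume : Measure (EuclideanSpace ℝ (Fin 3)))) := by
    rw [← hprod]
    exact hGc.aemeasurable (measurableSet_Icc.prod MeasurableSet.univ)
  have hstep3 : ∫⁻ p in Icc τ₁ τ₂ ×ˢ (univ : Set (EuclideanSpace ℝ (Fin 3))), G p =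
      ∫⁻ s in Icc τ₁ τ₂, ∫⁻ w, G (s, w) := by
    rw [hprod, lintegral_prod _ hGm]
  -- step 3: the inner integral is the Bochner integral
  have hinner : ∀ s ∈ Icc τ₁ τ₂, ∫⁻ w, G (s, w) = ENNReal.ofReal (g s) := by
    intro s hs
    have hs0 : s < 0 := hIcc0 s hs
    have hcs : Continuous fun w => frobeniusNormSq (fderiv ℝ (W s) w) * φ w :=
      (LerayHopfProofs.continuous_frobeniusNormSq.comp ((hW.contDiff_slice hs0).continuous_fderiv (by simp))).mul hφc
    have hint : Integrable fun w => frobeniusNormSq (fderiv ℝ (W s) w) * φ w :=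
      hcs.integrable_of_hasCompactSupport hφcs.mul_left
    rw [hg]; dsimp only
    rw [ofReal_integral_eq_lintegral_ofReal hint (ae_of_all _ fun w => mul_nonneg (frobeniusNormSq_nonneg _) (hφ0 w))]
  have hstep4 : ∫⁻ s in Icc τ₁ τ₂, ∫⁻ w, G (s, w) = ∫⁻ s in Icc τ₁ τ₂, ENNReal.ofReal (g s) :=
    setLIntegral_congr_fun measurableSet_Icc hinner
  -- step 4: the outer integral
  obtain ⟨q, hcl⟩ := hW.exists_isClassicalNSSolutionOn_Ioo (t₀ := τ₁ - 1) (by linarith [h12.trans h2])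
  have hgc : ContinuousOn g (Icc τ₁ τ₂) :=
    (hcl.continuousOn_integral_dissipation_cutoff isOpen_Ioo hφc hφcs).mono fun s hs => ⟨by linarith [hs.1], hIcc0 s hs⟩
  have hgint : IntegrableOn g (Icc τ₁ τ₂) := hgc.integrableOn_compact isCompact_Icc
  have hg0 : ∀ s, 0 ≤ g s := fun s => integral_nonneg fun w => mul_nonneg (frobeniusNormSq_nonneg _) (hφ0 w)
  have hstep5 : ∫⁻ s in Icc τ₁ τ₂, ENNReal.ofReal (g s) = ENNReal.ofReal (∫ s in Icc τ₁ τ₂, g s) :=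
    (ofReal_integral_eq_lintegral_ofReal hgint (ae_of_all _ hg0)).symm
  have hstep6 : ∫ s in Icc τ₁ τ₂, g s = ∫ s in τ₁..τ₂, g s := by
    rw [intervalIntegral.integral_of_le h12.le, integral_Icc_eq_integral_Ioc]
  calc dissMeasure W (Icc τ₁ τ₂ ×ˢ ball x R)
      ≤ ∫⁻ p in Icc τ₁ τ₂ ×ˢ ball x R, G p := hstep1
    _ ≤ ∫⁻ p in Icc τ₁ τ₂ ×ˢ (univ : Set (EuclideanSpace ℝ (Fin 3))), G p := hstep2
    _ = ∫⁻ s in Icc τ₁ τ₂, ∫⁻ w, G (s, w) := hstep3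
    _ = ∫⁻ s in Icc τ₁ τ₂, ENNReal.ofReal (g s) := hstep4
    _ = ENNReal.ofReal (∫ s in Icc τ₁ τ₂, g s) := hstep5
    _ = ENNReal.ofReal (∫ s in τ₁..τ₂, g s) := by rw [hstep6]

end NearExtremalTransiencePerFlow.DissipationLedger

end Summit.NavierStokesRegularity.NavierStokesRegularity.Theorems

end
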